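import Summits.HubbardSuperconductivity.HubbardSuperconductivity.Theorems.LevyLogBootstrapBlock2InfDivXXZRowHankel
import Summits.HubbardSuperconductivity.HubbardSuperconductivity.Theorems.LevyLogBootstrapBlock2InfDivXXZLevyReduction
import Literature.Probability.LatticeModels.TorusBlockFourier
import Literature.Probability.LatticeModels.CycleTwoBlockInfDiv
import HarnessLib

/-!
# Crux `Block2InfDivXXZ` (stmt-HubbardSuperconductivity-15048, route `LevyLogBootstrap`):
# the 2×2-block kernel is log-convex along every coarse axis at every centre `n ≥ 2` (RP), and is of
# negative log-type along the axis given the single local step `k₂(0) k₂(2E₁) ≥ k₂(E₁)²`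

Sibling of `…Block2InfDivXXZRowHankel.lean` (odd-shift Hankel positivity of the two-row transverse row
function `F`, from ground-state reflection positivity). Here:

* `sum_ite_originBlock_eq` — bookkeeping: the origin 2×2 block of the even torus is
  `{(a, b) : a, b < 2}`, so an origin-block indicator sum is a sum over `Fin 2 × Fin 2`;
* `coarseKernel_axis_eq_twoBlockSum` — the coarse block kernel of the crux
  (`k₂(X) = Σ_{⌊x'/2⌋ = X, ⌊y'/2⌋ = 0} Re⟨ψ, S⁺_{x'} S⁻_{y'} ψ⟩`, as in `…LevyReduction.lean`) on the
  coarse axis is the 2-block sum of the row function: `k₂(n, 0) = F(2n-1) + 2F(2n) + F(2n+1)`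
  (`twoBlockSum F (2n)`), `1 ≤ n < M/2`;
* `coarseKernel_axis_logConvex` (registered sub-goal) — **log-convexity along the axis**:
  `k₂(n, 0)² ≤ k₂(n-1, 0) · k₂(n+1, 0)` for `2 ≤ n ≤ M/2 - 2`, every `Δ ≤ 0`, even `M ≥ 4`, every
  normalised `S^z_tot = 0` sector ground state — an UNCONDITIONAL structural property of the object of
  the crux, from reflection positivity alone (`hankelBlock_logConvex`);
* `coarseKernel_axis_negLogType_of_localStep` (registered sub-goal) — IF moreover
  `k₂(1,0)² ≤ k₂(0,0) · k₂(2,0)` (the `n = 1` step, NOT a consequence of reflection positivity), then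
  `(A, B) ↦ -log k₂((A - B, 0))` is a negative definite kernel on the coarse cycle `ℤ/(M/2)`, i.e. the
  block kernel is infinitely divisible ALONG THE AXIS (`isNegDefKernel_negLog_twoBlock_of_hankelOddForm`:
  Hankel log-convexity for `n ≥ 2`, the local step, discrete Pólya on the cycle, Bochner).

This is the complete reflection-positivity content of the foreseen split `AxisInfDiv`; the residual
input is one local log-convexity inequality (evidence `ANALYSIS-w5-expansion.md` §4–6 on the item:
numerically `k₂(0)k₂(2E₁)/k₂(E₁)² ≈ 1.3–1.6`). No definition is introduced; sorry-free.
-/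

noncomputable section

set_option linter.dupNamespace false

namespace Summit.HubbardSuperconductivity.HubbardSuperconductivity.Theorems.LevyLogBootstrap

open scoped BigOperators Matrix ComplexOrder ComplexConjugate
open Matrix Finset Complex
open Literature.MathematicalPhysics.QuantumLattice Literature.Probability.LatticeModels
open Literature.Analysis.Matrix

/-! ### The origin block of the even torus -/

section OriginBlock

variable (M : ℕ) [NeZero M]

omit [NeZero M] in
/-- The four sites `(a, b)`, `a, b < 2`, of the torus (`M ≥ 3`), an injective family. [folklore] -/
theorem twoTwoSite_injective (h3 : 3 ≤ M) :
    Function.Injective fun ab : Fin 2 × Fin 2 =>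
      (![((ab.1 : ℕ) : ZMod M), ((ab.2 : ℕ) : ZMod M)] : TorusSite 2 M) := by
  intro p q h
  have h0 := congrFun h 0
  have h1 := congrFun h 1
  simp only [Matrix.cons_val_zero, Matrix.cons_val_one] at h0 h1
  have hv0 := congrArg ZMod.val h0
  have hv1 := congrArg ZMod.val h1
  rw [ZMod.val_natCast, ZMod.val_natCast, Nat.mod_eq_of_lt (by omega), Nat.mod_eq_of_lt (by omega)]
    at hv0 hv1
  exact Prod.ext (Fin.ext hv0) (Fin.ext hv1)

/-- **The origin 2×2 block is `{(a, b) : a, b < 2}`**: an origin-block indicator sum over the even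
torus (`M ≥ 3`) is the sum over the four offsets. [folklore] -/
theorem sum_ite_originBlock_eq (h3 : 3 ≤ M) (g : TorusSite 2 M → ℝ) :
    ∑ δ : TorusSite 2 M, (if (∀ i : Fin 2, (δ i).val / 2 = 0) then g δ else 0) =
      ∑ a : Fin 2, ∑ b : Fin 2, g ![((a : ℕ) : ZMod M), ((b : ℕ) : ZMod M)] := by
  classical
  set e : Fin 2 × Fin 2 → TorusSite 2 M := fun ab => ![((ab.1 : ℕ) : ZMod M), ((ab.2 : ℕ) : ZMod M)]
    with he
  have hinj : Function.Injective e := twoTwoSite_injective M h3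
  have hval : ∀ a : Fin 2, (((a : ℕ) : ZMod M)).val = (a : ℕ) := fun a => by
    rw [ZMod.val_natCast, Nat.mod_eq_of_lt (by omega)]
  -- the indicator set is the image of `e`
  have hset : (Finset.univ.filter fun δ : TorusSite 2 M => ∀ i : Fin 2, (δ i).val / 2 = 0) =
      (Finset.univ : Finset (Fin 2 × Fin 2)).image e := by
    ext δ
    simp only [Finset.mem_filter, Finset.mem_univ, true_and, Finset.mem_image]
    constructor
    · intro hδ
      have hlt : ∀ i : Fin 2, (δ i).val < 2 := fun i => by
        have := hδ i
        omega
      refine ⟨(⟨(δ 0).val, hlt 0⟩, ⟨(δ 1).val, hlt 1⟩), ?_⟩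
      rw [he]
      funext l
      fin_cases l
      · simp only [Fin.zero_eta, Matrix.cons_val_zero, ZMod.natCast_val, ZMod.cast_id', id_eq]
      · simp only [Fin.mk_one, Matrix.cons_val_one, Matrix.cons_val_zero, ZMod.natCast_val,
          ZMod.cast_id', id_eq]
    · rintro ⟨ab, rfl⟩ i
      fin_cases i
      · simp only [he, Fin.zero_eta, Matrix.cons_val_zero, hval]
        omega
      · simp only [he, Fin.mk_one, Matrix.cons_val_one, Matrix.cons_val_zero, hval]
        omega
  rw [← Finset.sum_filter, hset, Finset.sum_image fun p _ q _ h => hinj h, Fintype.sum_prod_type]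

end OriginBlock

/-- A real indicator term as the real part of a complex one. [folklore] -/
theorem ite_eq_re_ite_ofReal (P : Prop) [Decidable P] (r : ℝ) :
    (if P then r else 0) = (if P then ((r : ℝ) : ℂ) else 0).re := by
  split_ifs <;> simp

/-! ### The coarse kernel on the axis is the 2-block sum of the row function -/

section Axis

variable (M : ℕ) {m : ℕ} [NeZero M] [NeZero m]

/-- **The coarse block kernel on the coarse axis is the 2-block sum of the two-row row function**:
for `M = 2m ≥ 4`, a normalised `S^z_tot = 0` sector ground state `ψ` and `1 ≤ n < m`,
`k₂(n, 0) = F(2n - 1) + 2 F(2n) + F(2n + 1)` with `F(s) = Σ_{b,b'<2} Re⟨ψ, S⁺_{(s, b'-b)} S⁻_0 ψ⟩`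
(shift the block to the origin, enumerate the origin block, translation invariance). [folklore] -/
theorem coarseKernel_axis_eq_twoBlockSum (hM : M = 2 * m) (hEven : Even M) (h4 : 4 ≤ M) (Δ : ℝ)
    (ψ : TensorIndex (TorusSite 2 M) 2 → ℂ)
    (hψ : ψ ∈ @spinZSector (TorusSite 2 M) _ _ 1 0) (hnorm : star ψ ⬝ᵥ ψ = 1)
    (heig : Matrix.mulVec (xxzHamiltonian 1 (torusGraph 2 M) (-1) Δ) ψ =
      ((lowestEnergyInSector 1 (xxzHamiltonian 1 (torusGraph 2 M) (-1) Δ) 0 : ℝ) : ℂ) • ψ)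
    (n : ℕ) (hn1 : 1 ≤ n) (hnm : n < m) :
    (∑ x' : TorusSite 2 M, ∑ y' : TorusSite 2 M,
      if (∀ i : Fin 2, (x' i).val / 2 = ((![((n : ℕ) : ZMod m), 0] : TorusSite 2 m) i).val) ∧
          (∀ i : Fin 2, (y' i).val / 2 = 0) then
        (star ψ ⬝ᵥ Matrix.mulVec (onSite x' (spinRaise 1) * onSite y' (spinLower 1)) ψ).re
      else 0) =
    twoBlockSum (fun s : ℕ => ∑ b : Fin 2, ∑ b' : Fin 2,
        (star ψ ⬝ᵥ Matrix.mulVec (onSite (![((s : ℕ) : ZMod M), ((b' : ℕ) : ZMod M) - ((b : ℕ) : ZMod M)] :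
          TorusSite 2 M) (spinRaise 1) * onSite 0 (spinLower 1)) ψ).re) (2 * n) := by
  classical
  have h3 : 3 ≤ M := by omega
  set κ : TorusSite 2 M → ℝ := fun z =>
    (star ψ ⬝ᵥ Matrix.mulVec (onSite z (spinRaise 1) * onSite 0 (spinLower 1)) ψ).re with hκ
  have hKκ : ∀ x' y' : TorusSite 2 M,
      (star ψ ⬝ᵥ Matrix.mulVec (onSite x' (spinRaise 1) * onSite y' (spinLower 1)) ψ).re =
        κ (x' - y') :=
    fun x' y' => gs_transverseKernel_eq_sub M hEven Δ ψ hψ hnorm heig x' y'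
  set X : TorusSite 2 m := ![((n : ℕ) : ZMod m), 0] with hX
  -- (1) split the conjunction, (2) inner sums over the origin block, translation invariance
  simp only [ite_and, Finset.sum_ite_irrel, Finset.sum_const_zero, sum_ite_originBlock_eq M h3, hKκ]
  -- (3) shift the `x'` block to the origin: `x' = δ + (2n, 0)`
  have hshift := TorusBlock.sum_ite_block_eq_sum_ite_block_zero (d := 2) (b := 2) (M := M) (m := m) hM
    (fun x' : TorusSite 2 M => ((∑ a' : Fin 2, ∑ b' : Fin 2,
      κ (x' - ![((a' : ℕ) : ZMod M), ((b' : ℕ) : ZMod M)]) : ℝ) : ℂ)) X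
  have hshiftR : (∑ x' : TorusSite 2 M, if (∀ i : Fin 2, (x' i).val / 2 = (X i).val) then
      (∑ a' : Fin 2, ∑ b' : Fin 2, κ (x' - ![((a' : ℕ) : ZMod M), ((b' : ℕ) : ZMod M)])) else 0) =
      ∑ δ : TorusSite 2 M, if (∀ i : Fin 2, (δ i).val / 2 = 0) then
        (∑ a' : Fin 2, ∑ b' : Fin 2, κ (δ + (fun j => ((2 * (X j).val : ℕ) : ZMod M)) -
          ![((a' : ℕ) : ZMod M), ((b' : ℕ) : ZMod M)])) else 0 := by
    simp_rw [ite_eq_re_ite_ofReal]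
    rw [← Complex.re_sum, ← Complex.re_sum]
    exact congrArg Complex.re hshift
  rw [hshiftR, sum_ite_originBlock_eq M h3]
  -- (4) the shift vector is `(2n, 0)`
  have hnval : (((n : ℕ) : ZMod m)).val = n := by
    rw [ZMod.val_natCast, Nat.mod_eq_of_lt hnm]
  have hw : (fun j : Fin 2 => ((2 * (X j).val : ℕ) : ZMod M)) = ![(((2 * n : ℕ)) : ZMod M), 0] := by
    funext j
    fin_cases j
    · simp only [hX, Fin.zero_eta, Matrix.cons_val_zero, hnval]
    · simp only [hX, Fin.mk_one, Matrix.cons_val_one, Matrix.cons_val_zero, ZMod.val_zero, mul_zero,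
        Nat.cast_zero]
  rw [hw]
  -- (5) both sides are explicit sums over `a a' b b' : Fin 2`; compare term by term
  have hvec : ∀ (a b a' b' : Fin 2), (![((a : ℕ) : ZMod M), ((b : ℕ) : ZMod M)] : TorusSite 2 M) +
      ![(((2 * n : ℕ)) : ZMod M), 0] - ![((a' : ℕ) : ZMod M), ((b' : ℕ) : ZMod M)] =
        ![((a : ℕ) : ZMod M) + (((2 * n : ℕ)) : ZMod M) - ((a' : ℕ) : ZMod M),
          ((b : ℕ) : ZMod M) - ((b' : ℕ) : ZMod M)] := by
    intro a b a' b'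
    funext l
    fin_cases l
    · simp only [Fin.zero_eta, Pi.sub_apply, Pi.add_apply, Matrix.cons_val_zero]
    · simp only [Fin.mk_one, Pi.sub_apply, Pi.add_apply, Matrix.cons_val_one, Matrix.cons_val_zero,
        add_zero]
  simp_rw [hvec]
  rw [twoBlockSum]
  have c01 : ((((2 * n : ℕ)) : ZMod M)) - 1 = (((2 * n - 1 : ℕ)) : ZMod M) := by
    rw [Nat.cast_sub (by omega : 1 ≤ 2 * n), Nat.cast_one]
  have c10 : 1 + ((((2 * n : ℕ)) : ZMod M)) = (((2 * n + 1 : ℕ)) : ZMod M) := by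
    push_cast
    ring
  -- expand every binary sum; normalise the sixteen vector arguments
  simp only [Fin.sum_univ_two, Fin.val_zero, Fin.val_one, Nat.cast_zero, Nat.cast_one, zero_add,
    sub_zero, add_sub_cancel_left, sub_self, zero_sub]
  simp only [c01, c10]
  ring

/-! ### Consequences: log-convexity along the axis (RP alone) and axis negative log-type -/

/-- **Log-convexity of the 2×2-block kernel along a coarse axis (reflection positivity alone).**
For `M = 2m`, even `M ≥ 4`, `Δ ≤ 0`, every normalised `S^z_tot = 0` sector ground state `ψ` of
`H_M(Δ)` and every centre `2 ≤ n ≤ m - 2`, the coarse block kernel of the crux on the coarse axis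
satisfies `k₂(n, 0)² ≤ k₂(n-1, 0) · k₂(n+1, 0)` (`rowHankelOddForm_nonneg`,
`coarseKernel_axis_eq_twoBlockSum`, `hankelBlock_logConvex`). [folklore] -/
theorem coarseKernel_axis_logConvex (hM : M = 2 * m) (hEven : Even M) (h4 : 4 ≤ M) (Δ : ℝ)
    (hΔ : Δ ≤ 0) (ψ : TensorIndex (TorusSite 2 M) 2 → ℂ)
    (hψ : ψ ∈ @spinZSector (TorusSite 2 M) _ _ 1 0) (hnorm : star ψ ⬝ᵥ ψ = 1)
    (heig : Matrix.mulVec (xxzHamiltonian 1 (torusGraph 2 M) (-1) Δ) ψ =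
      ((lowestEnergyInSector 1 (xxzHamiltonian 1 (torusGraph 2 M) (-1) Δ) 0 : ℝ) : ℂ) • ψ)
    (n : ℕ) (hn : 2 ≤ n) (hnm : n + 2 ≤ m) :
    (∑ x' : TorusSite 2 M, ∑ y' : TorusSite 2 M,
      if (∀ i : Fin 2, (x' i).val / 2 = ((![((n : ℕ) : ZMod m), 0] : TorusSite 2 m) i).val) ∧
          (∀ i : Fin 2, (y' i).val / 2 = 0) then
        (star ψ ⬝ᵥ Matrix.mulVec (onSite x' (spinRaise 1) * onSite y' (spinLower 1)) ψ).re
      else 0) ^ 2 ≤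
    (∑ x' : TorusSite 2 M, ∑ y' : TorusSite 2 M,
      if (∀ i : Fin 2, (x' i).val / 2 = ((![((n - 1 : ℕ) : ZMod m), 0] : TorusSite 2 m) i).val) ∧
          (∀ i : Fin 2, (y' i).val / 2 = 0) then
        (star ψ ⬝ᵥ Matrix.mulVec (onSite x' (spinRaise 1) * onSite y' (spinLower 1)) ψ).re
      else 0) *
    (∑ x' : TorusSite 2 M, ∑ y' : TorusSite 2 M,
      if (∀ i : Fin 2, (x' i).val / 2 = ((![((n + 1 : ℕ) : ZMod m), 0] : TorusSite 2 m) i).val) ∧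
          (∀ i : Fin 2, (y' i).val / 2 = 0) then
        (star ψ ⬝ᵥ Matrix.mulVec (onSite x' (spinRaise 1) * onSite y' (spinLower 1)) ψ).re
      else 0) := by
  rw [coarseKernel_axis_eq_twoBlockSum M hM hEven h4 Δ ψ hψ hnorm heig n (by omega) (by omega),
    coarseKernel_axis_eq_twoBlockSum M hM hEven h4 Δ ψ hψ hnorm heig (n - 1) (by omega) (by omega),
    coarseKernel_axis_eq_twoBlockSum M hM hEven h4 Δ ψ hψ hnorm heig (n + 1) (by omega) (by omega)]
  have h := hankelBlock_logConvex _ m (rowHankelOddForm_nonneg M hM hEven h4 Δ hΔ ψ hψ hnorm heig) n hn hnm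
  have e1 : 2 * (n - 1) = 2 * n - 2 := by omega
  have e2 : 2 * (n + 1) = 2 * n + 2 := by omega
  rw [e1, e2]
  exact h

/-- Positivity of the coarse block kernel of a sector ground state on the axis (`Δ ∈ [-1, 0]`,
even `M ≥ 4`): every term is `≥ 0` and the term `(x', y') = ((2a, 0), 0)` is `> 0`
(`stub_transverseKernelPos`). [folklore] -/
theorem coarseKernel_axis_pos (hM : M = 2 * m) (hEven : Even M) (h4 : 4 ≤ M) (Δ : ℝ)
    (hΔ : Δ ∈ Set.Icc (-1:ℝ) 0) (ψ : TensorIndex (TorusSite 2 M) 2 → ℂ)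
    (hψ : ψ ∈ @spinZSector (TorusSite 2 M) _ _ 1 0) (hnorm : star ψ ⬝ᵥ ψ = 1)
    (heig : Matrix.mulVec (xxzHamiltonian 1 (torusGraph 2 M) (-1) Δ) ψ =
      ((lowestEnergyInSector 1 (xxzHamiltonian 1 (torusGraph 2 M) (-1) Δ) 0 : ℝ) : ℂ) • ψ)
    (a : ZMod m) :
    0 < ∑ x' : TorusSite 2 M, ∑ y' : TorusSite 2 M,
      if (∀ i : Fin 2, (x' i).val / 2 = ((![a, 0] : TorusSite 2 m) i).val) ∧
          (∀ i : Fin 2, (y' i).val / 2 = 0) then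
        (star ψ ⬝ᵥ Matrix.mulVec (onSite x' (spinRaise 1) * onSite y' (spinLower 1)) ψ).re
      else 0 := by
  have hK : ∀ x' y' : TorusSite 2 M, 0 < (star ψ ⬝ᵥ Matrix.mulVec
      (onSite x' (spinRaise 1) * onSite y' (spinLower 1)) ψ).re :=
    stub_transverseKernelPos M hEven h4 Δ hΔ ψ hψ hnorm heig
  have hterm : ∀ x' y' : TorusSite 2 M, 0 ≤ (if (∀ i : Fin 2, (x' i).val / 2 = ((![a, 0] : TorusSite 2 m) i).val) ∧
      (∀ i : Fin 2, (y' i).val / 2 = 0) then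
        (star ψ ⬝ᵥ Matrix.mulVec (onSite x' (spinRaise 1) * onSite y' (spinLower 1)) ψ).re else 0) := by
    intro x' y'
    split_ifs
    · exact (hK x' y').le
    · exact le_rfl
  -- the witness `x' = (2 a.val, 0)`, `y' = 0`
  set w : TorusSite 2 M := ![((2 * a.val : ℕ) : ZMod M), 0] with hw
  have haval : a.val < m := ZMod.val_lt a
  have hwit : (∀ i : Fin 2, (w i).val / 2 = ((![a, 0] : TorusSite 2 m) i).val) ∧
      (∀ i : Fin 2, ((0 : TorusSite 2 M) i).val / 2 = 0) := by
    refine ⟨fun i => ?_, fun i => by simp⟩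
    fin_cases i
    · simp only [hw, Fin.zero_eta, Matrix.cons_val_zero]
      rw [ZMod.val_natCast, Nat.mod_eq_of_lt (by omega)]
      omega
    · simp only [hw, Fin.mk_one, Matrix.cons_val_one, Matrix.cons_val_zero, ZMod.val_zero]
  have hdiag : 0 < (if (∀ i : Fin 2, (w i).val / 2 = ((![a, 0] : TorusSite 2 m) i).val) ∧
      (∀ i : Fin 2, ((0 : TorusSite 2 M) i).val / 2 = 0) then
        (star ψ ⬝ᵥ Matrix.mulVec (onSite w (spinRaise 1) * onSite 0 (spinLower 1)) ψ).re else 0) := by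
    rw [if_pos hwit]
    exact hK w 0
  refine lt_of_lt_of_le hdiag (le_trans ?_ (Finset.single_le_sum
    (fun x' _ => Finset.sum_nonneg fun y' _ => hterm x' y') (Finset.mem_univ w)))
  exact Finset.single_le_sum (fun y' _ => hterm w y') (Finset.mem_univ 0)

/-- **Axis negative log-type of the 2×2-block kernel, given the local step.** For `M = 2m`, even
`M ≥ 4`, `Δ ∈ [-1, 0]` and a normalised `S^z_tot = 0` sector ground state `ψ` of `H_M(Δ)`: IF
`k₂(1,0)² ≤ k₂(0,0) · k₂(2,0)` (the `n = 1` log-convexity step, not a consequence of reflection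
positivity), THEN `(A, B) ↦ -log k₂((A - B, 0))` is a negative definite kernel on the coarse cycle
`ℤ/m` — the block kernel is infinitely divisible along the axis (reflection positivity for `n ≥ 2`,
evenness, positivity, discrete Pólya + Bochner: `isNegDefKernel_negLog_twoBlock_of_hankelOddForm`).
[folklore] -/
theorem coarseKernel_axis_negLogType_of_localStep (hM : M = 2 * m) (hEven : Even M) (h4 : 4 ≤ M)
    (Δ : ℝ) (hΔ : Δ ∈ Set.Icc (-1:ℝ) 0) (ψ : TensorIndex (TorusSite 2 M) 2 → ℂ)
    (hψ : ψ ∈ @spinZSector (TorusSite 2 M) _ _ 1 0) (hnorm : star ψ ⬝ᵥ ψ = 1)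
    (heig : Matrix.mulVec (xxzHamiltonian 1 (torusGraph 2 M) (-1) Δ) ψ =
      ((lowestEnergyInSector 1 (xxzHamiltonian 1 (torusGraph 2 M) (-1) Δ) 0 : ℝ) : ℂ) • ψ)
    (hlocal : (∑ x' : TorusSite 2 M, ∑ y' : TorusSite 2 M,
      if (∀ i : Fin 2, (x' i).val / 2 = ((![1, 0] : TorusSite 2 m) i).val) ∧
          (∀ i : Fin 2, (y' i).val / 2 = 0) then
        (star ψ ⬝ᵥ Matrix.mulVec (onSite x' (spinRaise 1) * onSite y' (spinLower 1)) ψ).re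
      else 0) ^ 2 ≤
      (∑ x' : TorusSite 2 M, ∑ y' : TorusSite 2 M,
        if (∀ i : Fin 2, (x' i).val / 2 = ((![0, 0] : TorusSite 2 m) i).val) ∧
            (∀ i : Fin 2, (y' i).val / 2 = 0) then
          (star ψ ⬝ᵥ Matrix.mulVec (onSite x' (spinRaise 1) * onSite y' (spinLower 1)) ψ).re
        else 0) *
      (∑ x' : TorusSite 2 M, ∑ y' : TorusSite 2 M,
        if (∀ i : Fin 2, (x' i).val / 2 = ((![1 + 1, 0] : TorusSite 2 m) i).val) ∧
            (∀ i : Fin 2, (y' i).val / 2 = 0) then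
          (star ψ ⬝ᵥ Matrix.mulVec (onSite x' (spinRaise 1) * onSite y' (spinLower 1)) ψ).re
        else 0)) :
    IsNegDefKernel fun A B : TorusSite 1 m => -Real.log (∑ x' : TorusSite 2 M, ∑ y' : TorusSite 2 M,
      if (∀ i : Fin 2, (x' i).val / 2 = ((![(A - B) 0, 0] : TorusSite 2 m) i).val) ∧
          (∀ i : Fin 2, (y' i).val / 2 = 0) then
        (star ψ ⬝ᵥ Matrix.mulVec (onSite x' (spinRaise 1) * onSite y' (spinLower 1)) ψ).re
      else 0) := by
  set g : TorusSite 1 m → ℝ := fun A => ∑ x' : TorusSite 2 M, ∑ y' : TorusSite 2 M,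
      if (∀ i : Fin 2, (x' i).val / 2 = ((![A 0, 0] : TorusSite 2 m) i).val) ∧
          (∀ i : Fin 2, (y' i).val / 2 = 0) then
        (star ψ ⬝ᵥ Matrix.mulVec (onSite x' (spinRaise 1) * onSite y' (spinLower 1)) ψ).re
      else 0 with hg
  show IsNegDefKernel fun A B : TorusSite 1 m => -Real.log (g (A - B))
  have hgpos : ∀ A, 0 < g A := fun A => coarseKernel_axis_pos M hM hEven h4 Δ hΔ ψ hψ hnorm heig (A 0)
  have hgeven : ∀ A, g (-A) = g A := by
    intro A
    have h := coarseKernel_neg M hM hEven Δ ψ hψ hnorm heig (![A 0, 0] : TorusSite 2 m)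
    have hv : (-(![A 0, 0] : TorusSite 2 m)) = ![(-A) 0, 0] := by
      funext l
      fin_cases l
      · simp
      · simp
    rw [hv] at h
    exact h
  have hgtwo : ∀ A : TorusSite 1 m, A ≠ 0 → g A = twoBlockSum (fun s : ℕ => ∑ b : Fin 2, ∑ b' : Fin 2,
      (star ψ ⬝ᵥ Matrix.mulVec (onSite (![((s : ℕ) : ZMod M), ((b' : ℕ) : ZMod M) - ((b : ℕ) : ZMod M)] :
        TorusSite 2 M) (spinRaise 1) * onSite 0 (spinLower 1)) ψ).re) (2 * (A 0).val) := by
    intro A hA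
    have hn1 : 1 ≤ (A 0).val := by
      rw [Nat.one_le_iff_ne_zero]
      intro h0
      apply hA
      funext l
      rw [Subsingleton.elim l 0, (ZMod.val_eq_zero (A 0)).1 h0]
      rfl
    have h := coarseKernel_axis_eq_twoBlockSum M hM hEven h4 Δ ψ hψ hnorm heig (A 0).val hn1 (ZMod.val_lt _)
    rw [ZMod.natCast_zmod_val] at h
    exact h
  have hpsd := rowHankelOddForm_nonneg M hM hEven h4 Δ hΔ.2 ψ hψ hnorm heig
  refine isNegDefKernel_negLog_twoBlock_of_hankelOddForm _ g hgpos hgeven hgtwo hpsd ?_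
  -- the local step in `g`-form
  have e0 : g 0 = ∑ x' : TorusSite 2 M, ∑ y' : TorusSite 2 M,
      if (∀ i : Fin 2, (x' i).val / 2 = ((![0, 0] : TorusSite 2 m) i).val) ∧
          (∀ i : Fin 2, (y' i).val / 2 = 0) then
        (star ψ ⬝ᵥ Matrix.mulVec (onSite x' (spinRaise 1) * onSite y' (spinLower 1)) ψ).re else 0 := rfl
  have e1 : g (fun _ => 1) = ∑ x' : TorusSite 2 M, ∑ y' : TorusSite 2 M,
      if (∀ i : Fin 2, (x' i).val / 2 = ((![1, 0] : TorusSite 2 m) i).val) ∧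
          (∀ i : Fin 2, (y' i).val / 2 = 0) then
        (star ψ ⬝ᵥ Matrix.mulVec (onSite x' (spinRaise 1) * onSite y' (spinLower 1)) ψ).re else 0 := rfl
  have e2 : g ((fun _ => 1) + fun _ => 1) = ∑ x' : TorusSite 2 M, ∑ y' : TorusSite 2 M,
      if (∀ i : Fin 2, (x' i).val / 2 = ((![1 + 1, 0] : TorusSite 2 m) i).val) ∧
          (∀ i : Fin 2, (y' i).val / 2 = 0) then
        (star ψ ⬝ᵥ Matrix.mulVec (onSite x' (spinRaise 1) * onSite y' (spinLower 1)) ψ).re else 0 := rfl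
  rw [e0, e1, e2]
  exact hlocal

/-- **Registered form** (sub-goal `coarseKernel_axis_logConvex_all`). [folklore] -/
theorem coarseKernel_axis_logConvex_all :
    ∀ (M m : ℕ) [NeZero M] [NeZero m], M = 2 * m → Even M → 4 ≤ M → ∀ (Δ : ℝ), Δ ≤ 0 → ∀ (ψ :
      TensorIndex (TorusSite 2 M) 2 → ℂ), ψ ∈ @spinZSector (TorusSite 2 M) _ _ 1 0 → star ψ ⬝ᵥ ψ = 1
      → Matrix.mulVec (xxzHamiltonian 1 (torusGraph 2 M) (-1) Δ) ψ = ((lowestEnergyInSector 1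
      (xxzHamiltonian 1 (torusGraph 2 M) (-1) Δ) 0 : ℝ) : ℂ) • ψ → ∀ (n : ℕ), 2 ≤ n → n + 2 ≤ m → (∑
      x' : TorusSite 2 M, ∑ y' : TorusSite 2 M, if (∀ i : Fin 2, (x' i).val / 2 = ((![((n : ℕ) :
      ZMod m), 0] : TorusSite 2 m) i).val) ∧ (∀ i : Fin 2, (y' i).val / 2 = 0) then (star ψ ⬝ᵥ
      Matrix.mulVec (onSite x' (spinRaise 1) * onSite y' (spinLower 1)) ψ).re else 0) ^ 2 ≤ (∑ x' :
      TorusSite 2 M, ∑ y' : TorusSite 2 M, if (∀ i : Fin 2, (x' i).val / 2 = ((![((n - 1 : ℕ) : ZMod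
      m), 0] : TorusSite 2 m) i).val) ∧ (∀ i : Fin 2, (y' i).val / 2 = 0) then (star ψ ⬝ᵥ
      Matrix.mulVec (onSite x' (spinRaise 1) * onSite y' (spinLower 1)) ψ).re else 0) * (∑ x' :
      TorusSite 2 M, ∑ y' : TorusSite 2 M, if (∀ i : Fin 2, (x' i).val / 2 = ((![((n + 1 : ℕ) : ZMod
      m), 0] : TorusSite 2 m) i).val) ∧ (∀ i : Fin 2, (y' i).val / 2 = 0) then (star ψ ⬝ᵥ
      Matrix.mulVec (onSite x' (spinRaise 1) * onSite y' (spinLower 1)) ψ).re else 0) :=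
  fun M _ _ _ hM hEven h4 Δ hΔ ψ hψ hnorm heig n hn hnm =>
    coarseKernel_axis_logConvex M hM hEven h4 Δ hΔ ψ hψ hnorm heig n hn hnm

/-- **Registered form** (sub-goal `coarseKernel_axis_negLogType_of_localStep_all`). [folklore] -/
theorem coarseKernel_axis_negLogType_of_localStep_all :
    ∀ (M m : ℕ) [NeZero M] [NeZero m], M = 2 * m → Even M → 4 ≤ M → ∀ Δ ∈ Set.Icc (-1:ℝ) 0, ∀ (ψ :
      TensorIndex (TorusSite 2 M) 2 → ℂ), ψ ∈ @spinZSector (TorusSite 2 M) _ _ 1 0 → star ψ ⬝ᵥ ψ = 1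
      → Matrix.mulVec (xxzHamiltonian 1 (torusGraph 2 M) (-1) Δ) ψ = ((lowestEnergyInSector 1
      (xxzHamiltonian 1 (torusGraph 2 M) (-1) Δ) 0 : ℝ) : ℂ) • ψ → (∑ x' : TorusSite 2 M, ∑ y' :
      TorusSite 2 M, if (∀ i : Fin 2, (x' i).val / 2 = ((![1, 0] : TorusSite 2 m) i).val) ∧ (∀ i :
      Fin 2, (y' i).val / 2 = 0) then (star ψ ⬝ᵥ Matrix.mulVec (onSite x' (spinRaise 1) * onSite y'
      (spinLower 1)) ψ).re else 0) ^ 2 ≤ (∑ x' : TorusSite 2 M, ∑ y' : TorusSite 2 M, if (∀ i : Fin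
      2, (x' i).val / 2 = ((![0, 0] : TorusSite 2 m) i).val) ∧ (∀ i : Fin 2, (y' i).val / 2 = 0)
      then (star ψ ⬝ᵥ Matrix.mulVec (onSite x' (spinRaise 1) * onSite y' (spinLower 1)) ψ).re else
      0) * (∑ x' : TorusSite 2 M, ∑ y' : TorusSite 2 M, if (∀ i : Fin 2, (x' i).val / 2 = ((![1 + 1,
      0] : TorusSite 2 m) i).val) ∧ (∀ i : Fin 2, (y' i).val / 2 = 0) then (star ψ ⬝ᵥ Matrix.mulVec
      (onSite x' (spinRaise 1) * onSite y' (spinLower 1)) ψ).re else 0) → IsNegDefKernel fun A B :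
      TorusSite 1 m => -Real.log (∑ x' : TorusSite 2 M, ∑ y' : TorusSite 2 M, if (∀ i : Fin 2, (x'
      i).val / 2 = ((![(A - B) 0, 0] : TorusSite 2 m) i).val) ∧ (∀ i : Fin 2, (y' i).val / 2 = 0)
      then (star ψ ⬝ᵥ Matrix.mulVec (onSite x' (spinRaise 1) * onSite y' (spinLower 1)) ψ).re else
      0) :=
  fun M _ _ _ hM hEven h4 Δ hΔ ψ hψ hnorm heig hlocal =>
    coarseKernel_axis_negLogType_of_localStep M hM hEven h4 Δ hΔ ψ hψ hnorm heig hlocal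

end Axis

end Summit.HubbardSuperconductivity.HubbardSuperconductivity.Theorems.LevyLogBootstrap

end
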